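import Summits.Parity.GeneralizedHardyLittlewood.Theorems.PrimeLevelFamEdgeMomentsBeyondDiagonalDiagProfileCoord
import Summits.Parity.GeneralizedHardyLittlewood.Theorems.PrimeLevelFamEdgeMomentsBeyondDiagonalDiagPrimeSum
import Mathlib.NumberTheory.Chebyshev
import HarnessLib

/-!
# Route `PrimeLevelFamEdge`, crux K_A `MomentsBeyondDiagonal` (stmt-Parity-20007), line «petersson_layers» v4, stub `stub_diag`:
# **the prime coupling of a general profile: `𝒫_n = E_n·P′(u_n)/log M + O_P(D(n)(1+κ(n))/log²M)`**

Census item G5 (prime sum, pointwise in `n`) of the `stub_diag` repair census (`Lines/petersson_layers_stub_diag_g4_bricks.md`).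
In the kernel form of the profile `P` in Selberg coordinates (`quadForm_profile_eq`) the von Mangoldt coupling is
`𝒫_n = Σ_{j ≤ ⌊M⌋/n, j prime, j∤n}(log j/(j+1))·𝒮_{nj}` with `𝒮_{nj}` the profile coordinate at `nj`. Feeding
`𝒮_{nj} = E_{nj}P″(u_{nj})/log²M + O(D(nj)(…))` (`…DiagProfileCoord`), `E_{nj}·log j/(j+1) = E_n·log j/(j−1)`
(`mainConst_mul_prime`), `D(nj) ≤ 2D(n)` and the prime-sum engine
`Σ_{p≤y,p∤n}(log p/(p−1))logⁱ(y/p) = log^{i+1}y/(i+1) + O((19+κ(n))(1+log y)ⁱ)` (`…DiagPrimeSum`) at `y = M/n`: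

* `abs_primeCoupling_sub_le` — **for `P` with `P₀ = P₁ = 0`, `M ≥ 3`, `1 ≤ n ≤ M`:
  `|𝒫_n − E_n·(Σ_i P″_i u_n^{i+1}/(i+1))/log M| ≤ C_P·D(n)(1+κ(n))/log²M`**, `u_n = log(M/n)/log M`
  (and `Σ_i P″_i u^{i+1}/(i+1) = P′(u)`, `sum_coeff_derivative2_mul_pow_succ_eq`, since `P′(0) = 0`);
* the tail over `δ_{nj}` uses Chebyshev `θ(t) ≤ t·log 4` (Mathlib) through the dyadic lemma and
  `KernelFormXSqSumsB.sum_prime_log_div_succ_le`.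

Def-free; theorems only. Helper `--supports stmt-Parity-20007`; closes nothing; K_A, K_B and the Parity summit are
NOT proved; nothing about Landau–Siegel zeros.

## References
* E. Kowalski, P. Michel, J. VanderKam, J. reine angew. Math. 526 (2000), (23) p. 13 and Prop. 5.1 (31) p. 18
  (the Hecke/von Mangoldt coupling of the diagonal, evaluated by Mertens). [cite: KowalskiMichelVanderKam2000, Prop. 5.1 — derivation]
-/

noncomputable section

open scoped Real ArithmeticFunction.Moebius ArithmeticFunction.sigma ArithmeticFunction.zeta Chebyshev
open Finset ArithmeticFunction Polynomial

namespace Summit.Parity.GeneralizedHardyLittlewood.Theorems.MomentsBeyondDiagonal.DiagKernel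

open Literature.NumberTheory.LFunctions Literature.NumberTheory.LFunctions.KMV2000
open MollifierMainTerm (W)
open SelbergCoord (kappa)
open Literature.NumberTheory.Sieve (one_le_log_of_three_le)
open Summit.Parity.GeneralizedHardyLittlewood.Theorems.BeyondDiagonalBeatsQuarter.KernelFormXSq
  (copTauW mainConst divWeight divWeight_nonneg mainConst_nonneg mainConst_le_divWeight divWeight_prime_mul_le
    sum_dyadic_le sum_prime_log_div_succ_le)

/-! ### Small arithmetic facts -/

/-- `E_{nj} = E_n·(j+1)/(j−1)` for a prime `j ∤ n` (`n ≥ 1`). [folklore] -/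
theorem mainConst_mul_prime {n j : ℕ} (hn : n ≠ 0) (hj : j.Prime) (hjn : ¬ j ∣ n) :
    mainConst (n * j) = mainConst n * (((j : ℝ) + 1) / ((j : ℝ) - 1)) := by
  unfold mainConst
  have hpf : (n * j).primeFactors = insert j n.primeFactors := by
    rw [Nat.primeFactors_mul hn hj.ne_zero, hj.primeFactors, Finset.union_comm]
    rfl
  have hnot : j ∉ n.primeFactors := fun h ↦ hjn (Nat.dvd_of_mem_primeFactors h)
  rw [hpf, Finset.prod_insert hnot]
  ring

/-- The prime weight transfer: `(log j/(j+1))·E_{nj} = E_n·log j/(j−1)` for a prime `j ∤ n`. [folklore] -/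
theorem log_div_succ_mul_mainConst_mul {n j : ℕ} (hn : n ≠ 0) (hj : j.Prime) (hjn : ¬ j ∣ n) :
    Real.log j / ((j : ℝ) + 1) * mainConst (n * j) = mainConst n * (Real.log j / ((j : ℝ) - 1)) := by
  rw [mainConst_mul_prime hn hj hjn]
  have hj2 : (2 : ℝ) ≤ j := by exact_mod_cast hj.two_le
  have h1 : (j : ℝ) + 1 ≠ 0 := by linarith
  have h2 : (j : ℝ) - 1 ≠ 0 := by linarith
  field_simp

/-- Chebyshev in the dyadic-lemma format: `Σ_{j≤t}[j prime]log j = θ(t) ≤ log 4·t`. [folklore] -/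
theorem sum_ite_prime_log_le (t : ℕ) :
    ∑ j ∈ Icc 1 t, (if j.Prime then Real.log j else 0) ≤ Real.log 4 * t := by
  have h := Chebyshev.theta_le_log4_mul_x (Nat.cast_nonneg t)
  have he : θ (t : ℝ) = ∑ j ∈ Icc 1 t, (if j.Prime then Real.log j else 0) := by
    rw [Chebyshev.theta, Nat.floor_natCast, Finset.sum_filter]
    rfl
  rw [← he]
  exact h

/-- The dyadic prime sum: `Σ_{p≤y}(log p/p)/(1+log(y/p))² ≤ 8 log 4` for `y ≥ 1`. [folklore] -/
theorem sum_prime_log_div_dyadic_le {y : ℝ} (hy : 1 ≤ y) :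
    ∑ j ∈ Icc 1 ⌊y⌋₊, (if j.Prime then Real.log j else 0) / (j * (1 + Real.log (y / j)) ^ 2) ≤
      8 * Real.log 4 :=
  sum_dyadic_le (fun j ↦ by split_ifs <;> [exact Real.log_natCast_nonneg j; exact le_rfl])
    sum_ite_prime_log_le hy

/-- `Σ_i P″_i u^{i+1}/(i+1) = P′(u)` for `P` with `P₁ = 0` (the antiderivative of `P″` vanishing at `0` is `P′`).
[folklore] -/
theorem sum_coeff_derivative2_mul_pow_succ_eq (P : ℝ[X]) (hP1 : P.coeff 1 = 0) (u : ℝ) :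
    ∑ i ∈ Finset.range (P.natDegree + 1),
        (derivative (derivative P)).coeff i * u ^ (i + 1) / ((i : ℝ) + 1) = (derivative P).eval u := by
  have hdeg : (derivative P).natDegree < P.natDegree + 1 + 1 := by
    have := Polynomial.natDegree_derivative_le P
    omega
  rw [Polynomial.eval_eq_sum_range' hdeg]
  conv_rhs => rw [Finset.sum_range_succ']
  have h0 : (derivative P).coeff 0 = 0 := by
    rw [Polynomial.coeff_derivative, hP1]
    simp
  rw [h0, zero_mul, add_zero]
  refine Finset.sum_congr rfl fun i _ ↦ ?_
  simp only [Polynomial.coeff_derivative]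
  push_cast
  have h : (i : ℝ) + 1 ≠ 0 := by positivity
  field_simp

/-- Scalar bookkeeping for the tail: `2CD/ℓ²·8L + 2CD/ℓ³·(ℓ + ℓL) = 2C(8L + 1 + L)D/ℓ²` (`ℓ ≠ 0`). [folklore] -/
theorem tail_scalar_identity (C D L : ℝ) {ℓ : ℝ} (hℓ : ℓ ≠ 0) :
    2 * C * D / ℓ ^ 2 * (8 * L) + 2 * C * D / ℓ ^ 3 * (ℓ + ℓ * L) = 2 * C * (8 * L + 1 + L) * D / ℓ ^ 2 := by
  field_simp
  ring

/-- Scalar bookkeeping for the assembly: `aD(1+k) + bD ≤ (a+b+1)D(1+k)` for `bD, D, k ≥ 0`. [folklore] -/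
theorem final_scalar_le (a b D k : ℝ) (hb : 0 ≤ b * D) (hD : 0 ≤ D) (hk : 0 ≤ k) :
    a * D * (1 + k) + b * D ≤ (a + b + 1) * D * (1 + k) := by
  nlinarith [mul_nonneg hb hk, mul_nonneg hD hk]

/-! ### The prime coupling -/

set_option maxHeartbeats 400000 in
/-- **The prime coupling of a general profile.** For a real polynomial `P` with `P₀ = P₁ = 0` there is `C_P` such that
for all `M ≥ 3` and `1 ≤ n ≤ M`, with `𝒮_m = Σ_c P_c S⁽ᶜ⁾(M/m;m)/logᶜM` the profile coordinate,
`|Σ_{j≤⌊M⌋/n, j prime, j∤n}(log j/(j+1))𝒮_{nj} − E_n·(Σ_i P″_i u_n^{i+1}/(i+1))/log M| ≤ C_P·D(n)(1+κ(n))/log²M`,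
`u_n = log(M/n)/log M` (the bracket is `P′(u_n)`). [cite: KowalskiMichelVanderKam2000, Prop. 5.1 — derivation] -/
theorem abs_primeCoupling_sub_le (P : ℝ[X]) (hP0 : P.coeff 0 = 0) (hP1 : P.coeff 1 = 0) :
    ∃ C : ℝ, 0 < C ∧ ∀ M : ℝ, 3 ≤ M → ∀ n : ℕ, n ≠ 0 → (n : ℝ) ≤ M →
      |∑ j ∈ Icc 1 (⌊M⌋₊ / n), (if j.Prime ∧ ¬ j ∣ n then
          Real.log j / ((j : ℝ) + 1) *
            ∑ c ∈ Finset.range (P.natDegree + 1), P.coeff c *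
              ((∑ k ∈ Icc 1 ⌊M / ((n * j : ℕ) : ℝ)⌋₊,
                copTauW (n * j) k * Real.log (M / ((n * j : ℕ) : ℝ) / k) ^ c) / Real.log M ^ c)
          else 0) -
        mainConst n * (∑ i ∈ Finset.range (P.natDegree + 1),
          (derivative (derivative P)).coeff i * (Real.log (M / n) / Real.log M) ^ (i + 1) / ((i : ℝ) + 1)) /
            Real.log M| ≤
        C * divWeight n * (1 + kappa n) / Real.log M ^ 2 := by
  obtain ⟨C₁, hC₁, h1⟩ := abs_profileCoord_sub_derivative2_le P hP0 hP1
  obtain ⟨C_E, hC_E, hE⟩ := mainConst_le_divWeight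
  set Q := derivative (derivative P) with hQ
  set CQ : ℝ := ∑ i ∈ Finset.range (P.natDegree + 1), |Q.coeff i| * 2 ^ i with hCQ
  have hCQ0 : 0 ≤ CQ := Finset.sum_nonneg fun i _ ↦ by positivity
  refine ⟨C_E * CQ * 19 + 2 * C₁ * (8 * Real.log 4 + 1 + Real.log 4) + 1,
    by have := Real.log_nonneg (by norm_num : (1:ℝ) ≤ 4); positivity, fun M hM n hn hnM ↦ ?_⟩
  set ℓ := Real.log M with hℓ
  have hℓ1 : 1 ≤ ℓ := one_le_log_of_three_le hM
  have hℓ0 : 0 < ℓ := by linarith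
  have hM0 : 0 < M := by linarith
  have hn0' : (0 : ℝ) < n := by exact_mod_cast Nat.pos_of_ne_zero hn
  set y := M / n with hy
  have hy1 : 1 ≤ y := (one_le_div hn0').2 hnM
  have hy0 : 0 < y := by linarith
  obtain ⟨hly0, hlyℓ⟩ := log_div_nonneg_and_le hM hn hnM
  rw [← hy] at hly0 hlyℓ
  set K := ⌊M⌋₊ / n with hK
  have hKy : K = ⌊y⌋₊ := by rw [hK, hy, Nat.floor_div_natCast]
  have hD := divWeight_nonneg n
  have hE0 := mainConst_nonneg n
  have hEn := hE n hn
  have hκ : 0 ≤ kappa n := by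
    unfold kappa
    exact Finset.sum_nonneg fun p hp ↦ by
      have hp2 : (2 : ℝ) ≤ p := by exact_mod_cast (Nat.prime_of_mem_primeFactors hp).two_le
      exact div_nonneg (Real.log_nonneg (by linarith)) (by linarith)
  have hl4 : 0 ≤ Real.log 4 := Real.log_nonneg (by norm_num)
  -- facts about the summation range
  have hjK : ∀ j ∈ Icc 1 K, j ≠ 0 ∧ ((n * j : ℕ) : ℝ) ≤ M ∧ (1 : ℝ) ≤ j ∧ (j : ℝ) ≤ y := by
    intro j hj
    have hj' := Finset.mem_Icc.1 hj
    have hj0 : j ≠ 0 := by omega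
    have hnjM : n * j ≤ ⌊M⌋₊ := by
      have := Nat.mul_le_mul_left n hj'.2
      exact this.trans (Nat.mul_div_le ⌊M⌋₊ n)
    have hnjM' : ((n * j : ℕ) : ℝ) ≤ M := le_trans (by exact_mod_cast hnjM) (Nat.floor_le hM0.le)
    have hjy : (j : ℝ) ≤ y := by
      rw [hy, le_div_iff₀ hn0']
      calc (j : ℝ) * n = ((n * j : ℕ) : ℝ) := by push_cast; ring
        _ ≤ M := hnjM'
    exact ⟨hj0, hnjM', by exact_mod_cast hj'.1, hjy⟩
  have hlognj : ∀ j ∈ Icc 1 K, Real.log (M / ((n * j : ℕ) : ℝ)) = Real.log (y / j) := by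
    intro j _
    congr 1
    rw [hy]
    push_cast
    rw [div_div]
  -- abbreviations: the coordinate at `nj`, its main term and the engine sums
  obtain ⟨S, hS⟩ : ∃ S : ℕ → ℝ, ∀ j, S j = ∑ c ∈ Finset.range (P.natDegree + 1), P.coeff c *
    ((∑ k ∈ Icc 1 ⌊M / ((n * j : ℕ) : ℝ)⌋₊,
      copTauW (n * j) k * Real.log (M / ((n * j : ℕ) : ℝ) / k) ^ c) / ℓ ^ c) := ⟨_, fun j ↦ rfl⟩
  simp only [← hS]
  set m : ℕ → ℝ := fun j ↦ mainConst (n * j) * (Q.eval (Real.log (y / j) / ℓ) / ℓ ^ 2) with hm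
  set w : ℕ → ℝ := fun j ↦ if j.Prime ∧ ¬ j ∣ n then Real.log j / ((j : ℝ) + 1) else 0 with hw
  set v : ℕ → ℝ := fun j ↦ if j.Prime ∧ ¬ j ∣ n then Real.log j / ((j : ℝ) - 1) else 0 with hv
  have hw0 : ∀ j, 0 ≤ w j := by
    intro j
    simp only [hw]
    split_ifs with h
    · exact div_nonneg (Real.log_natCast_nonneg j) (by positivity)
    · exact le_rfl
  -- the sum splits as `Σ w·m + Σ w·(S − m)`
  have hsplit : ∑ j ∈ Icc 1 K, (if j.Prime ∧ ¬ j ∣ n then Real.log j / ((j : ℝ) + 1) * S j else 0) =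
      ∑ j ∈ Icc 1 K, w j * m j + ∑ j ∈ Icc 1 K, w j * (S j - m j) := by
    rw [← Finset.sum_add_distrib]
    refine Finset.sum_congr rfl fun j _ ↦ ?_
    simp only [hw]
    split_ifs <;> ring
  -- (1) the main part: `Σ w·m = (E_n/ℓ²)·Σ_i Q_i ℓ^{-i} Σ_j v_j logⁱ(y/j)`
  have hwm : ∀ j ∈ Icc 1 K, w j * m j =
      mainConst n / ℓ ^ 2 * ∑ i ∈ Finset.range (P.natDegree + 1), Q.coeff i / ℓ ^ i *
        (v j * Real.log (y / j) ^ i) := by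
    intro j hj
    simp only [hw, hv, hm]
    by_cases hp : j.Prime ∧ ¬ j ∣ n
    · have hdeg : Q.natDegree < P.natDegree + 1 := by
        have h1 := Polynomial.natDegree_derivative_le (derivative P)
        have h2 := Polynomial.natDegree_derivative_le P
        rw [hQ]; omega
      have hj1' : (j : ℝ) - 1 ≠ 0 := by
        have : (2 : ℝ) ≤ j := by exact_mod_cast hp.1.two_le
        linarith
      rw [if_pos hp, if_pos hp, ← mul_assoc, log_div_succ_mul_mainConst_mul hn hp.1 hp.2,
        Polynomial.eval_eq_sum_range' hdeg]
      simp only [Finset.mul_sum, Finset.sum_div]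
      refine Finset.sum_congr rfl fun i _ ↦ ?_
      rw [div_pow]
      field_simp
    · rw [if_neg hp, if_neg hp]
      simp
  have hmain_eq : ∑ j ∈ Icc 1 K, w j * m j =
      mainConst n / ℓ ^ 2 * ∑ i ∈ Finset.range (P.natDegree + 1), Q.coeff i / ℓ ^ i *
        ∑ j ∈ Icc 1 K, v j * Real.log (y / j) ^ i := by
    rw [Finset.sum_congr rfl hwm, ← Finset.mul_sum, Finset.sum_comm]
    congr 1
    refine Finset.sum_congr rfl fun i _ ↦ ?_
    rw [Finset.mul_sum]
  have htarget : mainConst n * (∑ i ∈ Finset.range (P.natDegree + 1),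
      Q.coeff i * (Real.log y / ℓ) ^ (i + 1) / ((i : ℝ) + 1)) / ℓ =
      mainConst n / ℓ ^ 2 * ∑ i ∈ Finset.range (P.natDegree + 1), Q.coeff i / ℓ ^ i *
        (Real.log y ^ (i + 1) / ((i : ℝ) + 1)) := by
    simp only [Finset.mul_sum, Finset.sum_div]
    refine Finset.sum_congr rfl fun i _ ↦ ?_
    have hi : (i : ℝ) + 1 ≠ 0 := by positivity
    rw [div_pow, pow_succ ℓ i]
    field_simp
  have hA : |∑ j ∈ Icc 1 K, w j * m j - mainConst n * (∑ i ∈ Finset.range (P.natDegree + 1),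
      Q.coeff i * (Real.log y / ℓ) ^ (i + 1) / ((i : ℝ) + 1)) / ℓ| ≤
      C_E * CQ * 19 * divWeight n * (1 + kappa n) / ℓ ^ 2 := by
    rw [hmain_eq, htarget, ← mul_sub, ← Finset.sum_sub_distrib, abs_mul,
      abs_of_nonneg (by positivity : 0 ≤ mainConst n / ℓ ^ 2)]
    have hi : ∀ i ∈ Finset.range (P.natDegree + 1),
        |Q.coeff i / ℓ ^ i * ∑ j ∈ Icc 1 K, v j * Real.log (y / j) ^ i -
          Q.coeff i / ℓ ^ i * (Real.log y ^ (i + 1) / ((i : ℝ) + 1))| ≤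
        |Q.coeff i| * 2 ^ i * (19 + kappa n) := by
      intro i _
      rw [← mul_sub, abs_mul, abs_div, abs_of_pos (pow_pos hℓ0 i)]
      have he := abs_sum_primeWeight_coprime_mul_log_pow_sub_le hn hy1 i
      rw [← hKy] at he
      have h2 : (1 + Real.log y) ^ i ≤ (2 * ℓ) ^ i := pow_le_pow_left₀ (by linarith) (by linarith) i
      calc |Q.coeff i| / ℓ ^ i * |∑ j ∈ Icc 1 K, v j * Real.log (y / j) ^ i - Real.log y ^ (i + 1) / ((i : ℝ) + 1)|
          ≤ |Q.coeff i| / ℓ ^ i * ((19 + kappa n) * (2 * ℓ) ^ i) :=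
            mul_le_mul_of_nonneg_left (he.trans (mul_le_mul_of_nonneg_left h2 (by linarith))) (by positivity)
        _ = |Q.coeff i| * 2 ^ i * (19 + kappa n) := by rw [mul_pow]; field_simp
    calc mainConst n / ℓ ^ 2 * |∑ i ∈ Finset.range (P.natDegree + 1),
            (Q.coeff i / ℓ ^ i * ∑ j ∈ Icc 1 K, v j * Real.log (y / j) ^ i -
              Q.coeff i / ℓ ^ i * (Real.log y ^ (i + 1) / ((i : ℝ) + 1)))|
        ≤ mainConst n / ℓ ^ 2 * ∑ i ∈ Finset.range (P.natDegree + 1), |Q.coeff i| * 2 ^ i * (19 + kappa n) :=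
          mul_le_mul_of_nonneg_left ((Finset.abs_sum_le_sum_abs _ _).trans (Finset.sum_le_sum hi)) (by positivity)
      _ = mainConst n * CQ * (19 + kappa n) / ℓ ^ 2 := by rw [← Finset.sum_mul, ← hCQ]; ring
      _ ≤ (C_E * divWeight n) * CQ * (19 + 19 * kappa n) / ℓ ^ 2 := by gcongr; nlinarith
      _ = C_E * CQ * 19 * divWeight n * (1 + kappa n) / ℓ ^ 2 := by ring
  -- (2) the tail over `δ_{nj} = S j − m j`
  have hB : |∑ j ∈ Icc 1 K, w j * (S j - m j)| ≤ 2 * C₁ * (8 * Real.log 4 + 1 + Real.log 4) * divWeight n / ℓ ^ 2 := by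
    have hterm : ∀ j ∈ Icc 1 K, |w j * (S j - m j)| ≤
        2 * C₁ * divWeight n / ℓ ^ 2 * ((if j.Prime then Real.log j else 0) / (j * (1 + Real.log (y / j)) ^ 2)) +
          (if j.Prime ∧ ¬ j ∣ n then Real.log j / ((j : ℝ) + 1) * (2 * C₁ * divWeight n / ℓ ^ 3) else 0) := by
      intro j hj
      obtain ⟨hj0, hnjM, hj1, hjy⟩ := hjK j hj
      have hj0' : (0 : ℝ) < j := by linarith
      by_cases hp : j.Prime ∧ ¬ j ∣ n
      · have hδ := h1 M hM (n * j) (mul_ne_zero hn hj0) hnjM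
        rw [hlognj j hj, ← hS j] at hδ
        have hDj : divWeight (n * j) ≤ 2 * divWeight n := by
          rw [mul_comm]; exact divWeight_prime_mul_le hp.1 hn
        have hlj : 0 ≤ Real.log (y / j) := Real.log_nonneg ((one_le_div hj0').2 hjy)
        simp only [hw, if_pos hp, if_pos hp.1]
        rw [abs_mul, abs_of_nonneg (hw0 j |>.trans_eq (by simp only [hw, if_pos hp]))]
        have hSm : |S j - m j| ≤ C₁ * (2 * divWeight n) * (1 / ((1 + Real.log (y / j)) ^ 2 * ℓ ^ 2) + 1 / ℓ ^ 3) := by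
          refine hδ.trans ?_
          gcongr
        have hwle : Real.log j / ((j : ℝ) + 1) ≤ Real.log j / j :=
          div_le_div_of_nonneg_left (Real.log_nonneg hj1) hj0' (by linarith)
        calc Real.log j / ((j : ℝ) + 1) * |S j - m j|
            ≤ Real.log j / ((j : ℝ) + 1) *
                (C₁ * (2 * divWeight n) * (1 / ((1 + Real.log (y / j)) ^ 2 * ℓ ^ 2) + 1 / ℓ ^ 3)) :=
              mul_le_mul_of_nonneg_left hSm (div_nonneg (Real.log_nonneg hj1) (by positivity))
          _ = Real.log j / ((j : ℝ) + 1) * (C₁ * (2 * divWeight n) / ((1 + Real.log (y / j)) ^ 2 * ℓ ^ 2)) +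
                Real.log j / ((j : ℝ) + 1) * (2 * C₁ * divWeight n / ℓ ^ 3) := by ring
          _ ≤ Real.log j / j * (C₁ * (2 * divWeight n) / ((1 + Real.log (y / j)) ^ 2 * ℓ ^ 2)) +
                Real.log j / ((j : ℝ) + 1) * (2 * C₁ * divWeight n / ℓ ^ 3) := by gcongr
          _ = 2 * C₁ * divWeight n / ℓ ^ 2 * (Real.log j / (j * (1 + Real.log (y / j)) ^ 2)) +
                Real.log j / ((j : ℝ) + 1) * (2 * C₁ * divWeight n / ℓ ^ 3) := by
              field_simp
      · simp only [hw, if_neg hp, zero_mul, abs_zero]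
        have : 0 ≤ (if j.Prime then Real.log j else 0) / (j * (1 + Real.log (y / j)) ^ 2) := by
          have hlj : 0 ≤ Real.log (y / j) := Real.log_nonneg ((one_le_div hj0').2 hjy)
          split_ifs
          · exact div_nonneg (Real.log_nonneg hj1) (by positivity)
          · simp
        positivity
    refine (Finset.abs_sum_le_sum_abs _ _).trans ((Finset.sum_le_sum hterm).trans ?_)
    rw [Finset.sum_add_distrib, ← Finset.mul_sum]
    have hd := sum_prime_log_div_dyadic_le hy1
    rw [← hKy] at hd
    have hm2 := sum_prime_log_div_succ_le n K (B := 2 * C₁ * divWeight n / ℓ ^ 3) (by positivity)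
    have hlogK : Real.log K ≤ ℓ := by
      rcases Nat.eq_zero_or_pos K with hK0 | hKpos
      · rw [hK0, Nat.cast_zero, Real.log_zero]; exact hℓ0.le
      · calc Real.log K ≤ Real.log y := Real.log_le_log (by exact_mod_cast hKpos) (by rw [hKy]; exact Nat.floor_le hy0.le)
          _ ≤ ℓ := hlyℓ
    calc 2 * C₁ * divWeight n / ℓ ^ 2 *
          ∑ j ∈ Icc 1 K, (if j.Prime then Real.log j else 0) / (j * (1 + Real.log (y / j)) ^ 2) +
          ∑ j ∈ Icc 1 K, (if j.Prime ∧ ¬ j ∣ n then Real.log j / ((j : ℝ) + 1) * (2 * C₁ * divWeight n / ℓ ^ 3) else 0)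
        ≤ 2 * C₁ * divWeight n / ℓ ^ 2 * (8 * Real.log 4) + 2 * C₁ * divWeight n / ℓ ^ 3 * (Real.log K + Real.log 4) :=
          add_le_add (mul_le_mul_of_nonneg_left hd (by positivity)) hm2
      _ ≤ 2 * C₁ * divWeight n / ℓ ^ 2 * (8 * Real.log 4) + 2 * C₁ * divWeight n / ℓ ^ 3 * (ℓ + ℓ * Real.log 4) := by
          have hstep : Real.log K + Real.log 4 ≤ ℓ + ℓ * Real.log 4 := by
            have := mul_nonneg (sub_nonneg.2 hℓ1) hl4
            nlinarith
          exact add_le_add le_rfl (mul_le_mul_of_nonneg_left hstep (by positivity))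
      _ = 2 * C₁ * (8 * Real.log 4 + 1 + Real.log 4) * divWeight n / ℓ ^ 2 :=
          tail_scalar_identity C₁ (divWeight n) (Real.log 4) hℓ0.ne'
  -- assemble
  have h1' : 0 ≤ 2 * C₁ * (8 * Real.log 4 + 1 + Real.log 4) * divWeight n :=
    mul_nonneg (mul_nonneg (mul_nonneg (by norm_num) hC₁.le) (by linarith)) hD
  rw [hsplit]
  generalize ∑ j ∈ Icc 1 K, w j * m j = X at hA ⊢
  generalize ∑ j ∈ Icc 1 K, w j * (S j - m j) = Y at hB ⊢
  generalize mainConst n * (∑ i ∈ Finset.range (P.natDegree + 1),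
    Q.coeff i * (Real.log y / ℓ) ^ (i + 1) / ((i : ℝ) + 1)) / ℓ = T at hA ⊢
  have e : X + Y - T = (X - T) + Y := by ring
  calc |X + Y - T| = |(X - T) + Y| := by rw [e]
    _ ≤ C_E * CQ * 19 * divWeight n * (1 + kappa n) / ℓ ^ 2 +
          2 * C₁ * (8 * Real.log 4 + 1 + Real.log 4) * divWeight n / ℓ ^ 2 := (abs_add_le _ _).trans (add_le_add hA hB)
    _ = (C_E * CQ * 19 * divWeight n * (1 + kappa n) +
          2 * C₁ * (8 * Real.log 4 + 1 + Real.log 4) * divWeight n) / ℓ ^ 2 := (add_div _ _ _).symm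
    _ ≤ (C_E * CQ * 19 + 2 * C₁ * (8 * Real.log 4 + 1 + Real.log 4) + 1) * divWeight n * (1 + kappa n) / ℓ ^ 2 :=
        div_le_div_of_nonneg_right (final_scalar_le _ _ _ _ h1' hD hκ) (pow_pos hℓ0 2).le

end Summit.Parity.GeneralizedHardyLittlewood.Theorems.MomentsBeyondDiagonal.DiagKernel

end
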